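import Mathlib
import Summits.PneNP.PneNP.Theorems.PstarGraphQuadGap
import Summits.PneNP.PneNP.Theorems.PstarProductRank
import Summits.PneNP.PneNP.Theorems.PstarInducedMatching
import Summits.PneNP.PneNP.Theorems.PstarGraphQuadGapOne
import Summits.PneNP.PneNP.Theorems.PstarLagrangian
import Summits.PneNP.PneNP.Theorems.PstarQuadBias

/-!
# Two quadratic forms on a bounded-degree graph: the `𝔽₂` analysis behind `GraphQuadGapTwo` (ROUND-24 item T24.11c, part I)

FRONTIER range-avoidance ladder, rung F-N3, ROUND 24 (cell `pnp-ideate`; restricted-model proof complexity — nothing here bears on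
`P` versus `NP`).  This part I holds the ingredients (packages, affine dichotomy, arithmetic); part II `PstarGraphQuadGapTwoCases`
the case analysis `two_forms_bound`; `PstarGraphQuadGapTwo` does the `QCon` bookkeeping and closes `PstarGraphQuadGap.GraphQuadGapTwo`.

**Setting.** `E` a simple graph on `Fin V` of maximum degree `Δ`; `T₁, T₂ ⊆ E`; two QUADRATIC functions
`f_i = qform T_i + L_i + c_i` on `𝔽₂^V`; an affine subspace `b₀ + D` of codimension `≤ t` on which
(unsat) no point has `f₁ = f₂ = 0`, and (edge-minimality) every edge `j ∈ E` has a point with `f_i = 0 ⇔ j ∉ T_i` (`i = 1,2`).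
**Theorem (part II, `PstarGraphQuadGapTwoCases.two_forms_bound`): `|E| ≤ 2Δ² · (2t + 3)`.**

**Proof.**  For each of the three forms `T ∈ {T₁, T₂, T₁ △ T₂}` (functions `f₁, f₂, f₁ + f₂`; over `𝔽₂` the polar form of
`T₁ △ T₂` is `B₁ + B₂`, `polar_symmDiff`) the package `form_package` provides `n_T ≤ dim D` with
(a) `|T| ≤ 2Δ² (V − n_T)` — `PstarLagrangian.exists_isotropic` gives an isotropic `N ≤ D` with `2 dim N ≥ dim D + dim rad_T(D)` and
`PstarGraphQuadGapOne.card_le_of_isotropic` counts edges against it; (b) `|ε_T| ≤ 2^{n_T}` for the bias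
`ε_T = Σ_{u ∈ D} (−1)^{f_T(b₀+u)}` — `PstarQuadBias.bias_sq_le`: `ε_T² ≤ |D|·|rad_T(D)| ≤ 2^{2 n_T}`; (c) `n_T = dim D` only if `D` is
`B_T`-isotropic.  Unsat gives `2^{dim D} ≤ |ε₁| + |ε₂| + |ε₁₂|` (`PstarQuadBias.card_le_abs_add`), so (`pow_three_cases`) either two
of the three `n_T` have `n + n' + 3 ≥ 2 dim D` — then the two forms cover `E` and `|E| ≤ 2Δ²(2V − n − n') ≤ 2Δ²(2t+3)` — or some
`n_T = dim D`: then `f_T` is AFFINE on `b₀ + D`, so either its bias vanishes (`affine_dichotomy`; rerun the count with two terms,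
`pow_two_cases`) or it is CONSTANT there, and edge-minimality pins `E` inside one form (`E ⊆ T₁`, `E ⊆ T₂` or `E ⊆ T₁ △ T₂`
according to the case) whose polar form vanishes on `D` (`const_iso`), giving `|E| ≤ 2Δ²(V − dim D) ≤ 2Δ² t`.
-/

set_option linter.dupNamespace false -- `Summit.PneNP.PneNP.…`: summit = sub-problem name (D-0017 single-conjunct layout)

open Finset Module
open scoped symmDiff
open Summit.PneNP.PneNP.Theorems.PstarProductRank
open Summit.PneNP.PneNP.Theorems.PstarInducedMatching (edgesAt)
open Summit.PneNP.PneNP.Theorems.PstarGraphQuadGap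
open Summit.PneNP.PneNP.Theorems.PstarGraphQuadGapOne
open Summit.PneNP.PneNP.Theorems.PstarLagrangian (exists_isotropic)
open Summit.PneNP.PneNP.Theorems.PstarQuadBias

namespace Summit.PneNP.PneNP.Theorems.PstarGraphQuadGapTwoForms

/-! ## Small `𝔽₂` facts -/

/-- In `𝔽₂`, `x + x = 0`. -/
private theorem zmod2_add_self (x : ZMod 2) : x + x = 0 := by
  revert x; decide

/-- A non-zero element of `𝔽₂` is `1`. -/
private theorem zmod2_eq_one_of_ne_zero {x : ZMod 2} (h : x ≠ 0) : x = 1 := by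
  revert x h; decide

/-- In an `𝔽₂`-space, `u + u = 0`. -/
private theorem vec_add_self {V : ℕ} (u : Fin V → ZMod 2) : u + u = 0 := by
  funext i; exact zmod2_add_self (u i)

/-- Sums over a symmetric difference, in `𝔽₂`. -/
theorem sum_symmDiff_zmod2 {κ : Type*} [DecidableEq κ] (s t : Finset κ) (h : κ → ZMod 2) :
    ∑ j ∈ s ∆ t, h j = ∑ j ∈ s, h j + ∑ j ∈ t, h j := by
  rw [symmDiff_def, sup_eq_union, sum_union disjoint_sdiff_sdiff, ← sum_inter_add_sum_sdiff s t h,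
    ← sum_inter_add_sum_sdiff t s h, inter_comm t s]
  have := zmod2_add_self (∑ x ∈ s ∩ t, h x)
  linear_combination -this

/-- Over `𝔽₂` the polar form of `T₁ △ T₂` is the sum of the polar forms. -/
theorem polar_symmDiff {V : ℕ} (T₁ T₂ : Finset (Edge V)) (x w : Fin V → ZMod 2) :
    polar (T₁ ∆ T₂) Prod.fst Prod.snd x w = polar T₁ Prod.fst Prod.snd x w + polar T₂ Prod.fst Prod.snd x w := by
  simp only [polar_apply]
  exact sum_symmDiff_zmod2 T₁ T₂ _

/-- Over `𝔽₂` the product sum of `T₁ △ T₂` is the sum of the product sums. -/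
theorem qform_symmDiff {V : ℕ} (T₁ T₂ : Finset (Edge V)) (x : Fin V → ZMod 2) :
    qform (T₁ ∆ T₂) Prod.fst Prod.snd x = qform T₁ Prod.fst Prod.snd x + qform T₂ Prod.fst Prod.snd x := by
  simp only [qform]
  exact sum_symmDiff_zmod2 T₁ T₂ _

/-! ## Arithmetic of three biases -/

/-- `2^d ≤ 2^a + 2^b` with `a, b ≤ d` forces `a = d`, `b = d`, or `a = b = d − 1`. -/
theorem pow_two_cases {d a b : ℕ} (ha : a ≤ d) (hb : b ≤ d) (h : 2 ^ d ≤ 2 ^ a + 2 ^ b) :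
    a = d ∨ b = d ∨ (a + 1 = d ∧ b + 1 = d) := by
  by_contra hc
  push Not at hc
  obtain ⟨h1, h2, h3⟩ := hc
  have hpos : 1 ≤ 2 ^ d := Nat.one_le_two_pow
  have ha1 : 2 ^ (a + 1) ≤ 2 ^ d := Nat.pow_le_pow_right (by norm_num) (by omega)
  have hb1 : 2 ^ (b + 1) ≤ 2 ^ d := Nat.pow_le_pow_right (by norm_num) (by omega)
  rw [pow_succ] at ha1 hb1
  by_cases ha' : a + 1 = d
  · have hb2 : 2 ^ (b + 2) ≤ 2 ^ d := Nat.pow_le_pow_right (by norm_num) (by omega)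
    rw [pow_add] at hb2
    norm_num at hb2
    omega
  · have ha2 : 2 ^ (a + 2) ≤ 2 ^ d := Nat.pow_le_pow_right (by norm_num) (by omega)
    rw [pow_add] at ha2
    norm_num at ha2
    omega

/-- `2^d ≤ 2^a + 2^b + 2^c` with `a, b, c ≤ d` forces one exponent to be `d` or two of them to have sum `≥ 2d − 3`. -/
theorem pow_three_cases {d a b c : ℕ} (ha : a ≤ d) (hb : b ≤ d) (hc : c ≤ d) (h : 2 ^ d ≤ 2 ^ a + 2 ^ b + 2 ^ c) :
    a = d ∨ b = d ∨ c = d ∨ 2 * d ≤ a + b + 3 ∨ 2 * d ≤ a + c + 3 ∨ 2 * d ≤ b + c + 3 := by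
  by_contra hcon
  push Not at hcon
  obtain ⟨h1, h2, h3, h12, h13, h23⟩ := hcon
  have key : ∀ {x y z : ℕ}, x < d → y < d → z < d → x + y + 4 ≤ 2 * d → x + z + 4 ≤ 2 * d → y + z + 4 ≤ 2 * d →
      2 ^ x + 2 ^ y + 2 ^ z < 2 ^ d := by
    intro x y z hx hy hz hxy hxz hyz
    have hpos : 1 ≤ 2 ^ d := Nat.one_le_two_pow
    by_cases hx1 : x + 1 = d
    · have e1 : 2 ^ (x + 1) ≤ 2 ^ d := Nat.pow_le_pow_right (by norm_num) (by omega)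
      have e2 : 2 ^ (y + 3) ≤ 2 ^ d := Nat.pow_le_pow_right (by norm_num) (by omega)
      have e3 : 2 ^ (z + 3) ≤ 2 ^ d := Nat.pow_le_pow_right (by norm_num) (by omega)
      rw [pow_add] at e1 e2 e3
      norm_num at e1 e2 e3
      omega
    by_cases hy1 : y + 1 = d
    · have e1 : 2 ^ (y + 1) ≤ 2 ^ d := Nat.pow_le_pow_right (by norm_num) (by omega)
      have e2 : 2 ^ (x + 3) ≤ 2 ^ d := Nat.pow_le_pow_right (by norm_num) (by omega)
      have e3 : 2 ^ (z + 3) ≤ 2 ^ d := Nat.pow_le_pow_right (by norm_num) (by omega)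
      rw [pow_add] at e1 e2 e3
      norm_num at e1 e2 e3
      omega
    by_cases hz1 : z + 1 = d
    · have e1 : 2 ^ (z + 1) ≤ 2 ^ d := Nat.pow_le_pow_right (by norm_num) (by omega)
      have e2 : 2 ^ (x + 3) ≤ 2 ^ d := Nat.pow_le_pow_right (by norm_num) (by omega)
      have e3 : 2 ^ (y + 3) ≤ 2 ^ d := Nat.pow_le_pow_right (by norm_num) (by omega)
      rw [pow_add] at e1 e2 e3
      norm_num at e1 e2 e3
      omega
    have e1 : 2 ^ (x + 2) ≤ 2 ^ d := Nat.pow_le_pow_right (by norm_num) (by omega)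
    have e2 : 2 ^ (y + 2) ≤ 2 ^ d := Nat.pow_le_pow_right (by norm_num) (by omega)
    have e3 : 2 ^ (z + 2) ≤ 2 ^ d := Nat.pow_le_pow_right (by norm_num) (by omega)
    rw [pow_add] at e1 e2 e3
    norm_num at e1 e2 e3
    omega
  exact absurd h (not_le.2 (key (lt_of_le_of_ne ha h1) (lt_of_le_of_ne hb h2) (lt_of_le_of_ne hc h3)
    (by omega) (by omega) (by omega)))

/-! ## One form: the package -/

variable {V : ℕ}

/-- Edge count of a sub-form against an isotropic subspace (the landed count, restricted to `T ⊆ E`). -/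
theorem card_le_of_isotropic_sub {E T : Finset (Edge V)} (Δ : ℕ) (hS : Simple E) (hΔ : EdgeMaxDegree Δ E) (hTE : T ⊆ E)
    {N : Submodule (ZMod 2) (Fin V → ZMod 2)} (hN : ∀ u ∈ N, ∀ v ∈ N, polar T Prod.fst Prod.snd u v = 0) :
    T.card ≤ 2 * Δ ^ 2 * (V - finrank (ZMod 2) N) := by
  have h := card_le_of_isotropic (K := ZMod 2) (J := T) (p := Prod.fst) (q := Prod.snd) Δ
    (fun e he => ne_of_lt (hS e (hTE he))) (fun e _ e' _ h1 h2 => Prod.ext h1 h2)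
    (fun e he e' he' h1 h2 => by
      have h3 := hS e (hTE he)
      have h4 := hS e' (hTE he')
      rw [← h1, ← h2] at h4
      exact absurd (h3.trans h4) (lt_irrefl _))
    (fun v => by
      unfold edgesAt
      exact (card_le_card (filter_subset_filter _ hTE)).trans (hΔ v)) hN
  simpa using h

/-- **The package of one form.**  For `T ⊆ E` and a quadratic `g` with polar form `B_T`, on the coset `b₀ + D`: an `n ≤ dim D` with
`|T| ≤ 2Δ²(V − n)`, `|ε| ≤ 2^n` for the bias `ε = Σ_{u ∈ D} χ(g(b₀+u))`, and `n = dim D` only if `D` is `B_T`-isotropic. -/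
theorem form_package {E T : Finset (Edge V)} (Δ : ℕ) (hS : Simple E) (hΔ : EdgeMaxDegree Δ E) (hTE : T ⊆ E)
    (D : Submodule (ZMod 2) (Fin V → ZMod 2)) (𝒟 : Finset (Fin V → ZMod 2)) (h𝒟 : ∀ x, x ∈ 𝒟 ↔ x ∈ D)
    (g : (Fin V → ZMod 2) → ZMod 2) (hg : ∀ x w, g (x + w) = g x + g w - g 0 + polar T Prod.fst Prod.snd x w)
    (b₀ : Fin V → ZMod 2) :
    ∃ n : ℕ, n ≤ finrank (ZMod 2) D ∧ T.card ≤ 2 * Δ ^ 2 * (V - n) ∧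
      |∑ u ∈ 𝒟, chi (g (b₀ + u))| ≤ 2 ^ n ∧
      (n = finrank (ZMod 2) D → ∀ u ∈ D, ∀ v ∈ D, polar T Prod.fst Prod.snd u v = 0) := by
  classical
  -- the polar form is alternating over `𝔽₂`
  have halt : ∀ v ∈ D, polar T Prod.fst Prod.snd v v = (0 : ZMod 2) := by
    intro v _
    have e := qform_add T Prod.fst Prod.snd v v
    have h0 : qform T Prod.fst Prod.snd (v + v) = (0 : ZMod 2) := by rw [vec_add_self]; simp [qform]
    have h2 := zmod2_add_self (qform T Prod.fst Prod.snd v)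
    rw [h0] at e
    linear_combination -h2 - e
  obtain ⟨N, hND, hNiso, hNdim⟩ := exists_isotropic (polar T Prod.fst Prod.snd) D halt
  refine ⟨finrank (ZMod 2) N, Submodule.finrank_mono hND, card_le_of_isotropic_sub Δ hS hΔ hTE hNiso, ?_, ?_⟩
  · obtain ⟨ℛ, hℛ⟩ : ∃ ℛ : Finset (Fin V → ZMod 2),
        ∀ x, x ∈ ℛ ↔ x ∈ D ∧ ∀ n ∈ D, polar T Prod.fst Prod.snd n x = 0 :=
      ⟨univ.filter fun x => x ∈ D ∧ ∀ n ∈ D, polar T Prod.fst Prod.snd n x = 0, fun x => by simp⟩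
    have hsq := bias_sq_le (polar T Prod.fst Prod.snd) g hg D 𝒟 ℛ h𝒟 hℛ b₀
    have h𝒟c : 𝒟.card = 2 ^ finrank (ZMod 2) D := card_eq_two_pow_finrank D 𝒟 h𝒟
    have hℛc : ℛ.card = 2 ^ finrank (ZMod 2) ↥(D ⊓ (polar T Prod.fst Prod.snd).orthogonal D) := by
      refine card_eq_two_pow_finrank _ ℛ fun x => ?_
      rw [hℛ, Submodule.mem_inf, LinearMap.BilinForm.mem_orthogonal_iff]
    have hle : (𝒟.card : ℤ) * ℛ.card ≤ (2 ^ finrank (ZMod 2) N : ℤ) ^ 2 := by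
      have hnat : 𝒟.card * ℛ.card ≤ (2 ^ finrank (ZMod 2) N) ^ 2 := by
        rw [h𝒟c, hℛc, ← pow_add, ← pow_mul]
        exact Nat.pow_le_pow_right (by norm_num) (by omega)
      exact_mod_cast hnat
    exact abs_le_of_sq_le_sq (hsq.trans hle) (by positivity)
  · intro hn
    have hEq : N = D := Submodule.eq_of_le_of_finrank_eq hND hn
    rw [← hEq]
    exact hNiso

/-! ## Affine forms: bias dichotomy and constancy -/

/-- **Affine dichotomy.**  If `D` is isotropic for the polar form of the quadratic `g` then `g` is affine on `b₀ + D`: either its bias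
there vanishes, or it is constant there. -/
theorem affine_dichotomy {T : Finset (Edge V)} (D : Submodule (ZMod 2) (Fin V → ZMod 2)) (𝒟 : Finset (Fin V → ZMod 2))
    (h𝒟 : ∀ x, x ∈ 𝒟 ↔ x ∈ D) (g : (Fin V → ZMod 2) → ZMod 2)
    (hg : ∀ x w, g (x + w) = g x + g w - g 0 + polar T Prod.fst Prod.snd x w) (b₀ : Fin V → ZMod 2)
    (hiso : ∀ u ∈ D, ∀ v ∈ D, polar T Prod.fst Prod.snd u v = 0) :
    (∑ u ∈ 𝒟, chi (g (b₀ + u))) = 0 ∨ ∀ u ∈ D, g (b₀ + u) = g b₀ := by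
  classical
  by_cases hconst : ∀ u ∈ D, g (b₀ + u) = g b₀
  · exact Or.inr hconst
  left
  push Not at hconst
  obtain ⟨u₁, hu₁, hne⟩ := hconst
  have h1 : g (b₀ + u₁) - g b₀ = 1 := zmod2_eq_one_of_ne_zero (sub_ne_zero.2 hne)
  refine sum_chi_eq_zero_of_shift 𝒟 u₁ (fun x hx => (h𝒟 _).2 (D.add_mem ((h𝒟 x).1 hx) hu₁)) (fun x => g (b₀ + x))
    fun x hx => ?_
  have hxD : x ∈ D := (h𝒟 x).1 hx
  have e1 := hg (b₀ + x) u₁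
  have e2 := hg b₀ u₁
  have e3 : polar T Prod.fst Prod.snd x u₁ = 0 := hiso x hxD u₁ hu₁
  rw [map_add, LinearMap.add_apply, e3, add_zero] at e1
  rw [show b₀ + (x + u₁) = b₀ + x + u₁ from (add_assoc _ _ _).symm, e1]
  linear_combination h1 - e2

/-- **Constancy ⇒ isotropy.**  If `qform T + L + c` is constant on `b₀ + D` then `D` is isotropic for the polar form of `T`. -/
theorem const_iso {T : Finset (Edge V)} (D : Submodule (ZMod 2) (Fin V → ZMod 2)) (g : (Fin V → ZMod 2) → ZMod 2)
    (L : (Fin V → ZMod 2) →ₗ[ZMod 2] ZMod 2) (c : ZMod 2) (hgdef : ∀ x, g x = qform T Prod.fst Prod.snd x + L x + c)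
    (b₀ : Fin V → ZMod 2) (hconst : ∀ u ∈ D, g (b₀ + u) = g b₀) :
    ∀ u ∈ D, ∀ v ∈ D, polar T Prod.fst Prod.snd u v = 0 := by
  intro u hu v hv
  refine polar_eq_zero_of_affine (V := D) (b := b₀) (c := g b₀ - c - L b₀) (ℓ := -L) (fun w hw => ?_) hu hv
  have e := hconst w hw
  rw [hgdef (b₀ + w), map_add] at e
  rw [LinearMap.neg_apply]
  linear_combination e

/-! ## The two-forms bound -/

section TwoForms

variable {E T₁ T₂ : Finset (Edge V)} {Δ t : ℕ} {D : Submodule (ZMod 2) (Fin V → ZMod 2)} {b₀ : Fin V → ZMod 2}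
  {f₁ f₂ : (Fin V → ZMod 2) → ZMod 2} {L₁ L₂ : (Fin V → ZMod 2) →ₗ[ZMod 2] ZMod 2} {c₁ c₂ : ZMod 2}

/-- Coverage: under unsat and edge-minimality every edge lies in `T₁ ∪ T₂`. -/
theorem mem_or_mem (hunsat : ∀ u ∈ D, f₁ (b₀ + u) ≠ 0 ∨ f₂ (b₀ + u) ≠ 0)
    (hmin : ∀ j ∈ E, ∃ u ∈ D, (f₁ (b₀ + u) = 0 ↔ j ∉ T₁) ∧ (f₂ (b₀ + u) = 0 ↔ j ∉ T₂)) :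
    ∀ j ∈ E, j ∈ T₁ ∨ j ∈ T₂ := by
  intro j hj
  obtain ⟨u, hu, h1, h2⟩ := hmin j hj
  by_contra h
  push Not at h
  rcases hunsat u hu with h' | h'
  · exact h' (h1.2 h.1)
  · exact h' (h2.2 h.2)

end TwoForms

end Summit.PneNP.PneNP.Theorems.PstarGraphQuadGapTwoForms
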